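import Summits.QuantumAdvantage.QuantumAdvantage.Theorems.CharDialFieldColC
import Summits.QuantumAdvantage.QuantumAdvantage.Theorems.CharDialSegmentMovesD
import HarnessLib

/-!
# CharDial / JLinPeel — FIELD COLUMNS, part E: the constant-column PREFIX cuts of `fieldY` — two-sided rigidity in every presentation
(route `CharDial`, item 32604; lens-6 node g18 §10.4 (c), first half)

The constant-column cut with prefix parameter `q ≤ sepM` (`q ≡ R (mod R+1)`, value `p·q`, residue `0`) is canonically the test
`[#{SENSITIVE i : u_i} ≡ 0 (mod p)]`, sensitive = the prefix `[0, p·q)` ∪ the tail `[p·sepM, n)` (`fieldCoef_const`, `gpre`, `fieldY_gpre`).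
In EVERY junta ⊕ one-form presentation `D` of `fieldY p n α`:
* ★ `pre_coef_ne_zero` — rigidity (i): a SENSITIVE coordinate outside the presented junta has NON-ZERO presented coefficient (part A's flip criterion
  `flip_zero` at `u = 0`, `W = {i}`);
* `tailC` / `card_tailC` — the tail `[p·sepM, n)` has `≥ n − n/3` coordinates; ★ `pre_active` — the presented TABLE of the cut is NOT constant in the
  form value as soon as the junta misses a tail coordinate (`u = 0` is accepted, `𝟙_{j}` is not, and they agree on the junta);
* ★★ `pre_coef_eq_zero` — rigidity (ii): an IGNORED coordinate `p·q ≤ i < p·sepM` outside the junta has presented coefficient ZERO, provided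
  `p + #J ≤ #tail`: otherwise flipping `u_i` shifts the presented form by `±ε ≠ 0` at constant output, subset sums over the junta-free tail
  (`SegMove.subsetSum_surj`, all presented tail coefficients non-zero by (i)) realise every form value, so the table is `ε`-periodic, hence constant
  — contradicting `pre_active`.  (Port of the annex's `res2_coef_eq_zero`, §38j, to the constant column.)

Prop-free, 0 sorry.  Part F (next file) runs the zone-pivot rank argument on these cuts and assembles class-five membership.
-/

set_option autoImplicit false

namespace Summit.QuantumAdvantage.AdviceFreeQNC0.JLinPeel.FieldCol

open Finset MaskDial BlockDial

/-! #### (9) the constant-column PREFIX cuts: canonical pattern, rigidity in every presentation -/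
section PrefixCuts
variable (p : ℕ) [hp : Fact p.Prime]
open SegMove

/-- the canonical coefficient vector of a CONSTANT-COLUMN cut with prefix parameter `q ≤ sepM`: `1` on the prefix `[0, p·q)` and on the
tail `[p·sepM, n)`, `0` on the ignored zone `[p·q, p·sepM)`. -/
theorem fieldCoef_const (n : ℕ) (α : GaloisField p (rk n)) (q : ℕ) (i : Fin n) :
    fieldCoef p n α q ⟨rk n, Nat.lt_succ_self _⟩ i
      = if (i.val < p * q ∨ p * NullDial.sepM p n ≤ i.val) then 1 else 0 := by
  unfold fieldCoef
  rw [col_last]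
  by_cases h1 : i.val < p * NullDial.sepM p n
  · rw [if_pos h1]
    by_cases h2 : i.val < p * q
    · rw [if_pos h2, if_pos (Or.inl h2)]
    · rw [if_neg h2, if_neg (by push Not; exact ⟨by omega, by omega⟩)]
  · rw [if_neg h1, if_pos (Or.inr (by omega))]

/-- a constant-column prefix cut: value `p·q` with `q ≡ R (mod R+1)`. -/
def gpre (n q : ℕ) (hfit : p * q ≤ n) : Fin (n + 1) := ⟨p * q, Nat.lt_succ_of_le hfit⟩

/-- its residue is `0`. -/
theorem gpre_cast (n q : ℕ) (hfit : p * q ≤ n) : ((((gpre p n q hfit : Fin (n + 1)) : ℕ) : ZMod p)) = 0 := by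
  show (((p * q : ℕ)) : ZMod p) = 0
  rw [Nat.cast_mul, ZMod.natCast_self, zero_mul]

/-- its prefix parameter is `q`. -/
theorem gpre_div (n q : ℕ) (hfit : p * q ≤ n) : (gpre p n q hfit).val / p = q := by
  show p * q / p = q
  exact Nat.mul_div_cancel_left _ hp.out.pos

/-- its column is the constant column when `q ≡ R (mod R+1)`. -/
theorem colIdx_gpre (n q : ℕ) (hfit : p * q ≤ n) (hqR : q % (rk n + 1) = rk n) :
    colIdx p n (gpre p n q hfit) = ⟨rk n, Nat.lt_succ_self _⟩ := by
  ext
  show (gpre p n q hfit).val / p % (rk n + 1) = rk n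
  rw [gpre_div, hqR]

/-- the strategy at a constant-column prefix cut: `[0 = #{sensitive i : u_i} (mod p)]`. -/
theorem fieldY_gpre (n : ℕ) (α : GaloisField p (rk n)) (q : ℕ) (hfit : p * q ≤ n) (hqR : q % (rk n + 1) = rk n)
    (u : Fin n → Bool) :
    fieldY p n α (gpre p n q hfit) u
      = decide ((0 : ZMod p) = ∑ i, if u i then (if (i.val < p * q ∨ p * NullDial.sepM p n ≤ i.val) then (1 : ZMod p) else 0) else 0) := by
  unfold fieldY
  rw [gpre_cast]
  have hc : fieldCoef p n α ((gpre p n q hfit).val / p) (colIdx p n (gpre p n q hfit))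
      = fun i : Fin n => if (i.val < p * q ∨ p * NullDial.sepM p n ≤ i.val) then (1 : ZMod p) else 0 := by
    funext i
    rw [gpre_div, colIdx_gpre p n q hfit hqR, fieldCoef_const]
  rw [hc]

/-- **rigidity (i) at a constant-column prefix cut**: every SENSITIVE coordinate outside the presented junta has NON-ZERO presented
coefficient (flip criterion at `u = 0`, `W = {i}`: canonically the coefficient is `1`). -/
theorem pre_coef_ne_zero (n : ℕ) (α : GaloisField p (rk n)) (q : ℕ) (hfit : p * q ≤ n) (hqR : q % (rk n + 1) = rk n)
    (D : JLinData p n) (hD : D.strat = fieldY p n α) (i : Fin n) (hi : i.val < p * q ∨ p * NullDial.sepM p n ≤ i.val)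
    (hiJ : i ∉ D.J (gpre p n q hfit)) : D.a (gpre p n q hfit) i ≠ 0 := by
  classical
  intro h0
  have h := flip_zero D (gpre p n q hfit) (fun i : Fin n => if (i.val < p * q ∨ p * NullDial.sepM p n ≤ i.val) then (1 : ZMod p) else 0)
    (fun u => by rw [hD]; exact fieldY_gpre p n α q hfit hqR u)
    {i} (fun j hj => by rw [Finset.mem_singleton] at hj; rw [hj]; exact hiJ) (by rw [Finset.sum_singleton]; exact h0)
  rw [Finset.sum_singleton, if_pos hi] at h
  exact one_ne_zero h

/-- the TAIL coordinates `[p·sepM, n)` (sensitive for every constant-column cut). -/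
def tailC (p n : ℕ) : Finset (Fin n) := univ.filter fun i : Fin n => p * NullDial.sepM p n ≤ i.val

omit hp in
/-- the tail has `n − p·sepM ≥ n − n/3` coordinates. -/
theorem card_tailC (n : ℕ) : n - p * NullDial.sepM p n ≤ (tailC p n).card := by
  classical
  have hM : p * NullDial.sepM p n ≤ n := le_trans (NullDial.p_mul_sepM_le p n) (Nat.div_le_self n 3)
  let f : Fin (n - p * NullDial.sepM p n) → Fin n := fun k => ⟨p * NullDial.sepM p n + k.val, by have := k.isLt; omega⟩
  have hcard : (univ : Finset (Fin (n - p * NullDial.sepM p n))).card = n - p * NullDial.sepM p n := by simp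
  rw [← hcard]
  refine Finset.card_le_card_of_injOn f ?_ ?_
  · intro k _
    rw [mem_coe]
    unfold tailC
    rw [mem_filter]
    exact ⟨mem_univ _, Nat.le_add_right _ _⟩
  · intro k _ k' _ hkk
    have := congrArg Fin.val hkk
    exact Fin.ext (by simpa [f] using this)

/-- **an ACTIVE table**: in every presentation whose junta at a constant-column prefix cut misses some tail coordinate, the table of that
cut is NOT constant in the form value (else the output would be junta-determined; but `u = 0` is accepted and `u = 𝟙_{j}` is not). -/
theorem pre_active (n : ℕ) (α : GaloisField p (rk n)) (q : ℕ) (hfit : p * q ≤ n) (hqR : q % (rk n + 1) = rk n)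
    (D : JLinData p n) (hD : D.strat = fieldY p n α) (htail : (D.J (gpre p n q hfit)).card < (tailC p n).card) :
    ¬ ∀ (u : Fin n → Bool) (s s' : ZMod p), D.h (gpre p n q hfit) u s = D.h (gpre p n q hfit) u s' := by
  classical
  intro hconst
  set g := gpre p n q hfit with hg
  obtain ⟨j, hjt, hjJ⟩ : ∃ j ∈ tailC p n, j ∉ D.J g := Finset.exists_mem_notMem_of_card_lt_card htail
  have hj : j.val < p * q ∨ p * NullDial.sepM p n ≤ j.val := by
    unfold tailC at hjt; exact Or.inr (mem_filter.1 hjt).2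
  set u0 : Fin n → Bool := fun _ => false with hu0
  set u1 : Fin n → Bool := fun i => decide (i ∈ ({j} : Finset (Fin n))) with hu1
  have hagree : ∀ i ∈ D.J g, u0 i = u1 i := by
    intro i hi
    have hij : i ≠ j := fun h => hjJ (h ▸ hi)
    simp [u0, u1, hij]
  have hpres : D.strat g u0 = D.strat g u1 := by
    show D.h g u0 (D.form g u0) = D.h g u1 (D.form g u1)
    rw [hconst u0 (D.form g u0) (D.form g u1), D.hJ g u0 u1 hagree]
  rw [hD, hg, fieldY_gpre p n α q hfit hqR, fieldY_gpre p n α q hfit hqR] at hpres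
  have h0 : decide ((0 : ZMod p) = ∑ i, if u0 i then (if (i.val < p * q ∨ p * NullDial.sepM p n ≤ i.val) then (1 : ZMod p) else 0) else 0)
      = true := by simp [u0]
  have h1 : (∑ i, if u1 i then (if (i.val < p * q ∨ p * NullDial.sepM p n ≤ i.val) then (1 : ZMod p) else 0) else 0) = 1 := by
    rw [hu1, Summit.QuantumAdvantage.AdviceFreeQNC0.JLinPeel.MaskDial.ite_mem_sum, Finset.sum_singleton, if_pos hj]
  rw [h0, h1] at hpres
  have : (0 : ZMod p) = 1 := decide_eq_true_eq.mp hpres.symm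
  exact one_ne_zero this.symm

/-- **rigidity (ii) at a constant-column prefix cut**: every IGNORED coordinate `p·q ≤ i < p·sepM` outside the presented junta has presented
coefficient ZERO — else flipping `u_i` shifts the presented form by `±ε ≠ 0` without changing the output, subset sums over the tail (all presented
tail coefficients are non-zero by rigidity (i)) make the table `ε`-periodic hence constant, contradicting `pre_active`. -/
theorem pre_coef_eq_zero (n : ℕ) (α : GaloisField p (rk n)) (q : ℕ) (hfit : p * q ≤ n) (hqR : q % (rk n + 1) = rk n)
    (D : JLinData p n) (hD : D.strat = fieldY p n α) (hbig : p + (D.J (gpre p n q hfit)).card ≤ (tailC p n).card)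
    (i : Fin n) (h1 : p * q ≤ i.val) (h2 : i.val < p * NullDial.sepM p n) (hiJ : i ∉ D.J (gpre p n q hfit)) :
    D.a (gpre p n q hfit) i = 0 := by
  classical
  have hp1 : 1 ≤ p := hp.out.one_lt.le
  by_contra h0
  set g := gpre p n q hfit with hg
  set a' := D.a g
  set T := tailC p n \ D.J g with hT
  have hTnz : ∀ j ∈ T, a' j ≠ 0 := by
    intro j hj
    rcases mem_sdiff.1 hj with ⟨hjt, hjJ⟩
    unfold tailC at hjt
    exact pre_coef_ne_zero p n α q hfit hqR D hD j (Or.inr (mem_filter.1 hjt).2) hjJ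
  have hTcard : p ≤ T.card + 1 := by
    have := le_card_sdiff (D.J g) (tailC p n)
    rw [← hT] at this
    omega
  have hiT : i ∉ tailC p n := by
    unfold tailC; rw [mem_filter]; push Not; intro _; exact h2
  have hcan0 : (fun k : Fin n => if (k.val < p * q ∨ p * NullDial.sepM p n ≤ k.val) then (1 : ZMod p) else 0) i = 0 := by
    show (if (i.val < p * q ∨ p * NullDial.sepM p n ≤ i.val) then (1 : ZMod p) else 0) = 0
    rw [if_neg (by push Not; exact ⟨h1, h2⟩)]
  have hstep1 : ∀ u : Fin n → Bool,
      D.h g u (form a' u + (if u i = true then -a' i else a' i)) = D.h g u (form a' u) := by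
    intro u
    have hu := congrFun (congrFun hD g) u
    have hv := congrFun (congrFun hD g) (Function.update u i (!u i))
    have hy : fieldY p n α g (Function.update u i (!u i)) = fieldY p n α g u := by
      rw [hg, fieldY_gpre p n α q hfit hqR, fieldY_gpre p n α q hfit hqR]
      have := form_update_of_zero (fun k : Fin n => if (k.val < p * q ∨ p * NullDial.sepM p n ≤ k.val) then (1 : ZMod p) else 0) u i hcan0 (!u i)
      unfold form at this
      rw [this]
    have hJ : ∀ k ∈ D.J g, Function.update u i (!u i) k = u k := by
      intro k hk; rw [Function.update_of_ne (ne_of_mem_of_not_mem hk hiJ)]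
    have hf : form a' (Function.update u i (!u i)) = form a' u + (if u i = true then -a' i else a' i) := by
      rw [form_update]
      cases u i <;> simp [sub_eq_add_neg]
    have : D.strat g (Function.update u i (!u i)) = D.strat g u := by rw [hu, hv, hy]
    change D.h g (Function.update u i (!u i)) (form a' (Function.update u i (!u i))) = D.h g u (form a' u) at this
    rwa [D.hJ g _ u hJ, hf] at this
  have hstep2 : ∀ (u : Fin n → Bool) (σ : ZMod p), ∃ w : Fin n → Bool,
      (∀ k ∈ D.J g, w k = u k) ∧ w i = u i ∧ form a' w = σ := by
    intro u σ
    let u₀ : Fin n → Bool := fun k => if k ∈ T then false else u k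
    obtain ⟨S, hS, hsum⟩ := subsetSum_surj a' T hTnz hTcard (form a' u₀) σ
    refine ⟨fun k => if k ∈ S then true else u₀ k, ?_, ?_, ?_⟩
    · intro k hk
      have hkT : k ∉ T := fun h => (mem_sdiff.1 h).2 hk
      have hkS : k ∉ S := fun h => hkT (hS h)
      simp [u₀, hkS, hkT]
    · have hiT' : i ∉ T := fun h => hiT (mem_sdiff.1 h).1
      have hiS : i ∉ S := fun h => hiT' (hS h)
      simp [u₀, hiS, hiT']
    · rw [form_setTrue a' u₀ S (fun j hj => by simp [u₀, hS hj]), hsum]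
  have hstep3 : ∀ (u : Fin n → Bool) (σ : ZMod p),
      D.h g u (σ + (if u i = true then -a' i else a' i)) = D.h g u σ := by
    intro u σ
    obtain ⟨w, hwJ, hwi, hwσ⟩ := hstep2 u σ
    have h1' := hstep1 w
    rw [hwσ, hwi, D.hJ g w u hwJ, D.hJ g w u hwJ] at h1'
    exact h1'
  have hlt : (D.J g).card < (tailC p n).card := by omega
  refine pre_active p n α q hfit hqR D hD hlt ?_
  intro u s s'
  set ε : ZMod p := if u i = true then -a' i else a' i with hε
  have hε0 : ε ≠ 0 := by
    rw [hε]; split_ifs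
    · exact neg_ne_zero.2 h0
    · exact h0
  have hk : ∀ k : ℕ, D.h g u (s + (k : ZMod p) * ε) = D.h g u s := by
    intro k
    induction k with
    | zero => simp
    | succ k ih =>
      have := hstep3 u (s + (k : ZMod p) * ε)
      push_cast
      rw [add_mul, one_mul, ← add_assoc, this, ih]
  have := hk ((s' - s) * ε⁻¹).val
  rw [ZMod.natCast_zmod_val, inv_mul_cancel_right₀ hε0, add_sub_cancel] at this
  exact this.symm

end PrefixCuts

end Summit.QuantumAdvantage.AdviceFreeQNC0.JLinPeel.FieldCol
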